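import Literature.AlgebraicGeometry.Resolution.QuadraticTransformWeakTransform
import Summits.ResolutionOfSingularities.ResolutionOfSingularities.Theorems.ValuativeLuAlphaPTorsorNePow

/-!
# Primes of the quadratic transform: the exceptional curve versus strict transforms

Helper file for the stub `prime_quadraticTransform_dichotomy` (P1b) of the line
`pfaff-line-log-final-forms` (crux `Valuative.LuAlphaPTorsor`, item
`stmt-ResolutionOfSingularities-0641`).

Setting: `R ⊆ K` a two-dimensional regular local ring dominated by the valuation ring `O`, `R₁`
its quadratic transform along `O` (`IsQuadraticTransformAlong O R R₁`), `x ∈ 𝔪 = 𝔪_R` of minimal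
value (the exceptional parameter: `R₁ = (R[𝔪/x])_{𝔪_O ∩ R[𝔪/x]}`, `𝔪 R₁ = x R₁`), and
`φ : R → R₁` the inclusion. Phase 1 of Giraud's induction tracks the support of the divisorial
part of the log-content ideal along the quadratic sequence; the primes `𝔭 ≠ 𝔪_{R₁}` of `R₁`
split into

* the exceptional curve: if `φ x ∈ 𝔭` then `𝔭 = (φ x)` and `𝔭 ∩ R = 𝔪` — in the chart
  `A = R[y/x]` (`𝔪 = (x, y)`), `R₁ = A_Q` and `𝔭 = P A_Q` for the prime `P = 𝔭 ∩ A ∋ x`,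
  `P < Q`; the exceptional prime `xA` (`A/xA ≅ κ[X]`) satisfies `xA ≤ P`, and `xA < P < Q` is
  excluded by `dim A ≤ 2` (`eq_of_span_lt_of_le`), so `P = xA`; and `𝔪 ⊆ (x)R₁ ∩ R ⊊ R`;
* strict transforms: if `φ x ∉ 𝔭 ≠ 0` then `𝔭 ∩ R ≠ 𝔪` (as `x ∉ 𝔭 ∩ R`) and `𝔭 ∩ R ≠ 0`
  (a non-zero `z = a/b ∈ 𝔭`, `a, b ∈ R`, gives `0 ≠ a = z b ∈ 𝔭 ∩ R`).

References: O. Zariski, P. Samuel, *Commutative Algebra* II (1960), Appendix 5;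
C. Huneke, I. Swanson, *Integral Closure of Ideals, Rings, and Modules* (2006), §14.2.
-/

set_option linter.dupNamespace false

noncomputable section

open IsLocalRing Literature.AlgebraicGeometry.Resolution

namespace Summit.ResolutionOfSingularities.ResolutionOfSingularities.Theorems.PfaffLine

section PrimeDichotomy

variable {K : Type*} [Field K]

/-- **The quadratic transform along `O` is the local ring at the centre of the chart of ANY
element of minimal value**: if `0 ≠ x ∈ 𝔪_R` has minimal value then
`R₁ = (R[𝔪/x])_{𝔪_O ∩ R[𝔪/x]}` (uniqueness of the quadratic transform along `O`,
`IsQuadraticTransformAlong.unique`). [folklore] -/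
theorem eq_locAtCentre_blowupRing_primeDichotomy (O : ValuationSubring K) (R R₁ : Subring K)
    [IsLocalRing R] [IsNoetherianRing R] (h : IsQuadraticTransformAlong O R R₁) {x : R}
    (hxm : x ∈ maximalIdeal R) (hx0 : x ≠ 0)
    (hmin : ∀ z ∈ maximalIdeal R, O.valuation (z : K) ≤ O.valuation ((x : R) : K)) :
    R₁ = locAtCentre (blowupRing R ((x : R) : K)) O := by
  classical
  obtain ⟨s, hs⟩ := (isNoetherianRing_iff_ideal_fg R).mp ‹_› (maximalIdeal R)
  have hspan : Ideal.span (↑(insert x s) : Set R) = maximalIdeal R := by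
    rw [Finset.coe_insert, Ideal.span_insert, hs, sup_eq_right]
    exact (Ideal.span_singleton_le_iff_mem _).mpr hxm
  refine h.unique ⟨‹_›, h.source_le, insert x s, x, hspan, Finset.mem_insert_self x s, hx0,
    fun z hz => hmin z (hspan ▸ Ideal.subset_span (Finset.mem_coe.mpr hz)), ?_⟩
  rw [blowupRing_eq_closure_of_span_eq ((x : R) : K) _ hspan]

/-- **Primes of `A_Q` adjacent to an ideal `p` of `A`.** If no prime of `A ⊆ K` lies strictly
between `p` and the prime `Q` (every prime `P` with `p ≤ P ≤ Q` is `p` or `Q`), then a prime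
`𝔭 ≠ 𝔪` of `A_Q = LocalSubring.ofPrime A Q` containing `p A_Q` equals `p A_Q`: indeed
`𝔭 = (𝔭 ∩ A) A_Q` with `p ≤ 𝔭 ∩ A ≤ Q`, and `𝔭 ∩ A = Q` would give `𝔭 = Q A_Q = 𝔪`.
[folklore] -/
theorem eq_map_of_forall_prime_between_primeDichotomy {A : Subring K} (Q : Ideal A) [Q.IsPrime]
    {p : Ideal A} (hp : ∀ (P : Ideal A) [P.IsPrime], p ≤ P → P ≤ Q → P = p ∨ P = Q)
    (𝔭 : Ideal (LocalSubring.ofPrime A Q).toSubring) [𝔭.IsPrime]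
    (h𝔭m : 𝔭 ≠ maximalIdeal (LocalSubring.ofPrime A Q).toSubring)
    (hp𝔭 : p.map (algebraMap A (LocalSubring.ofPrime A Q).toSubring) ≤ 𝔭) :
    𝔭 = p.map (algebraMap A (LocalSubring.ofPrime A Q).toSubring) := by
  -- `𝔭 = (𝔭 ∩ A) A_Q` with `p ≤ 𝔭 ∩ A ≤ Q`
  have hmapP : (𝔭.comap (algebraMap A (LocalSubring.ofPrime A Q).toSubring)).map
      (algebraMap A (LocalSubring.ofPrime A Q).toSubring) = 𝔭 :=
    IsLocalization.map_under Q.primeCompl _ 𝔭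
  have hPQ : 𝔭.comap (algebraMap A (LocalSubring.ofPrime A Q).toSubring) ≤ Q :=
    (Ideal.comap_mono (IsLocalRing.le_maximalIdeal (Ideal.IsPrime.ne_top ‹_›))).trans_eq
      (IsLocalization.AtPrime.under_maximalIdeal (LocalSubring.ofPrime A Q).toSubring Q)
  have hpP : p ≤ 𝔭.comap (algebraMap A (LocalSubring.ofPrime A Q).toSubring) :=
    Ideal.map_le_iff_le_comap.mp hp𝔭
  rcases hp _ hpP hPQ with hP | hP
  · rw [← hmapP, hP]
  · exfalso
    apply h𝔭m
    rw [← hmapP, hP]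
    exact IsLocalization.AtPrime.map_eq_maximalIdeal Q _

/-- **No prime of the chart lies strictly between the exceptional prime and another prime.** For
`𝔪 = (x, y)` in a two-dimensional regular local ring `R ⊆ K` (`x` prime, `x ∤ y`) and the chart
`A = R[y/x]`: the exceptional ideal `xA = 𝔪A` is prime (`A/xA ≅ κ[X]`), and a prime `P` with
`xA ≤ P ≤ Q` (`Q` prime) is `xA` or `Q`, since `0 < xA < P < Q` would be a chain of length
`3 > dim A` (`eq_of_span_lt_of_le`). [folklore] -/
theorem forall_prime_between_chart_primeDichotomy {R : Subring K} [IsRegularLocalRing R]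
    (hdim : ringKrullDim R = 2) {x y : R} (hm : maximalIdeal R = Ideal.span {x, y})
    (hx0 : x ≠ 0) (hpq : ∀ t, x ∣ y * t → x ∣ t) (Q : Ideal (chartAdjoin (K := K) x y))
    [Q.IsPrime] :
    ∀ (P : Ideal (chartAdjoin (K := K) x y)) [P.IsPrime],
      Ideal.span {chartIncl (K := K) x y x} ≤ P → P ≤ Q →
        P = Ideal.span {chartIncl (K := K) x y x} ∨ P = Q := by
  have hxm : x ∈ maximalIdeal R := hm ▸ Ideal.subset_span (by simp)
  have hym : y ∈ maximalIdeal R := hm ▸ Ideal.subset_span (by simp)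
  -- the exceptional prime `xA = 𝔪A`
  have h𝔭x : (Ideal.span {chartIncl (K := K) x y x}).IsPrime := by
    rw [← map_maximalIdeal_chartIncl hm hx0]
    exact isPrime_map_incl (K := K) hx0 hpq hxm hym
  intro P _ hxP hPQ
  by_cases hPeq : P = Ideal.span {chartIncl (K := K) x y x}
  · exact Or.inl hPeq
  · exact Or.inr (eq_of_span_lt_of_le hdim hx0 h𝔭x (lt_of_le_of_ne hxP (Ne.symm hPeq)) hPQ)

end PrimeDichotomy

/-- **Registered stub `prime_quadraticTransform_dichotomy`** (P1b: primes of the quadratic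
transform — the exceptional curve versus strict transforms). Let `R ⊆ K` be a two-dimensional
regular local ring dominated by the valuation ring `O`, `R₁` its quadratic transform along `O`,
`x ∈ 𝔪` of minimal value and `φ : R → R₁` the inclusion. For a prime `𝔭 ≠ 𝔪_{R₁}` of `R₁`:
(i) if `φ x ∈ 𝔭` then `𝔭 = (φ x)` and `𝔭 ∩ R = 𝔪`; (ii) if `φ x ∉ 𝔭 ≠ 0` then `𝔭 ∩ R` is
neither `𝔪` nor `0`. Proof: `R₁ = (R[y/x])_Q` for `𝔪 = (x, y)` (`x ∉ 𝔪²` being the chart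
element); (i) `𝔭 ∩ R[y/x]` is a prime between the exceptional prime `x R[y/x]` and `Q`, other
than `Q`, hence equal to `x R[y/x]` (`dim R[y/x] ≤ 2`), and `𝔪 ⊆ (x)R₁ ∩ R ⊊ R` as
`z = (z/x) x`; (ii) `x ∉ 𝔭 ∩ R`, and a non-zero `z = a/b ∈ 𝔭` (`a, b ∈ R`) gives
`0 ≠ a = z b ∈ 𝔭 ∩ R`. [folklore] -/
theorem prime_quadraticTransform_dichotomy : ∀ {K : Type} [Field K] (O : ValuationSubring K) (R R₁ : Subring K) [IsRegularLocalRing R] [IsLocalRing R₁] (h : Literature.AlgebraicGeometry.Resolution.IsQuadraticTransformAlong O R R₁), ringKrullDim R = 2 → Literature.AlgebraicGeometry.Resolution.SubringDominates R O.toSubring → ∀ (x : R), x ∈ maximalIdeal R → (∀ z ∈ maximalIdeal R, O.valuation (z : K) ≤ O.valuation (x : K)) → ∀ (𝔭 : Ideal R₁), 𝔭.IsPrime → 𝔭 ≠ maximalIdeal R₁ → (Subring.inclusion h.le x ∈ 𝔭 → 𝔭 = Ideal.span {Subring.inclusion h.le x} ∧ 𝔭.comap (Subring.inclusion h.le) =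 maximalIdeal R) ∧ (Subring.inclusion h.le x ∉ 𝔭 → 𝔭 ≠ ⊥ → 𝔭.comap (Subring.inclusion h.le) ≠ maximalIdeal R ∧ 𝔭.comap (Subring.inclusion h.le) ≠ ⊥) := by
  intro K _ O R R₁ _ _ h hdim hdom x hxm hmin 𝔭 h𝔭 h𝔭m
  classical
  haveI := h𝔭
  -- `x ≠ 0`, `R₁ = (R[𝔪/x])_{𝔪_O ∩ R[𝔪/x]}`, `x ∉ 𝔪²`, `𝔪 = (x, y)`
  have hx0 : x ≠ 0 := by
    -- else `𝔪 = 0` (all values `≤ ν(0)`), but `𝔪` is not principal (`dim R = 2`)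
    intro hx
    apply maximalIdeal_ne_span_singleton hdim (0 : R)
    rw [Ideal.span_singleton_zero, eq_bot_iff]
    intro z hz
    have h1 := hmin z hz
    rw [hx, ZeroMemClass.coe_zero, map_zero, le_zero_iff, map_eq_zero] at h1
    exact (Submodule.mem_bot R).mpr (ZeroMemClass.coe_eq_zero.mp h1)
  have hx0K : ((x : R) : K) ≠ 0 := fun e => hx0 (Subtype.ext e)
  have hq : IsQuadraticTransform R R₁ := h.isQuadraticTransform hdom
  have hR₁ : R₁ = locAtCentre (blowupRing R ((x : R) : K)) O :=
    eq_locAtCentre_blowupRing_primeDichotomy O R R₁ h hxm hx0 hmin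
  have hT : blowupRing R ((x : R) : K) ≤ R₁ := hR₁ ▸ le_locAtCentre _ O
  have hx2 : x ∉ maximalIdeal R ^ 2 := IsQuadraticTransform.chart_not_mem_sq hT hq.dominates hx0
  obtain ⟨y, hm, hxp, hxy⟩ := exists_maximalIdeal_eq_span_pair_of_not_mem_sq hdim hxm hx2
  have hpq : ∀ t, x ∣ y * t → x ∣ t := fun t ht => (hxp.dvd_or_dvd ht).resolve_left hxy
  -- `𝔪 ⊆ (φ x) R₁ ∩ R`: `z = (z/x) · x`
  have hmle : maximalIdeal R ≤
      (Ideal.span {Subring.inclusion h.le x}).comap (Subring.inclusion h.le) := by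
    intro z hz
    rw [Ideal.mem_comap, Ideal.mem_span_singleton']
    refine ⟨⟨((z : R) : K) / ((x : R) : K), hT (div_mem_blowupRing _ hz)⟩, Subtype.ext ?_⟩
    change ((z : R) : K) / ((x : R) : K) * ((x : R) : K) = ((z : R) : K)
    exact div_mul_cancel₀ _ hx0K
  refine ⟨fun hx𝔭 => ?_, fun hx𝔭 h𝔭0 => ⟨fun heq => hx𝔭 ?_, fun hbot => ?_⟩⟩
  rotate_left
  · -- (ii) `𝔭 ∩ R = 𝔪` would contain `x`
    have hx' : x ∈ 𝔭.comap (Subring.inclusion h.le) := heq ▸ hxm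
    exact Ideal.mem_comap.mp hx'
  · -- (ii) `𝔭 ∩ R ≠ 0`: a non-zero `z = a / b ∈ 𝔭` gives `0 ≠ a = z b ∈ 𝔭 ∩ R`
    obtain ⟨z, hz𝔭, hz0⟩ := Submodule.exists_mem_ne_zero_of_ne_bot h𝔭0
    obtain ⟨a, ha, b, hb, hb0, hzab⟩ :=
      exists_eq_div_of_mem_subfieldClosure (le_subfieldClosure_of_isQuadraticTransformAlong h z.2)
    have ha𝔭 : (⟨a, ha⟩ : R) ∈ 𝔭.comap (Subring.inclusion h.le) := by
      rw [Ideal.mem_comap]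
      have e : Subring.inclusion h.le ⟨a, ha⟩ = z * Subring.inclusion h.le ⟨b, hb⟩ :=
        Subtype.ext (by
          change a = (z : K) * b
          rw [hzab, div_mul_cancel₀ _ hb0])
      rw [e]
      exact 𝔭.mul_mem_right _ hz𝔭
    rw [hbot, Ideal.mem_bot] at ha𝔭
    have ha0 : a = 0 := congrArg Subtype.val ha𝔭
    apply hz0
    apply Subtype.ext
    rw [hzab, ha0, zero_div]
    rfl
  · -- (i) the exceptional curve: pass to the chart `A = R[y/x]`, `R₁ = A_Q`
    have hA : blowupRing R ((x : R) : K) = chartAdjoin (K := K) x y := blowupRing_eq_adjoin hm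
    have hAO : chartAdjoin (K := K) x y ≤ O.toSubring := hA.ge.trans (hT.trans h.target_le)
    have hbetween := forall_prime_between_chart_primeDichotomy hdim hm hx0 hpq
      (subringCentre (chartAdjoin (K := K) x y) O hAO)
    have hR₁T : R₁ = (LocalSubring.ofPrime (chartAdjoin (K := K) x y)
        (subringCentre (chartAdjoin (K := K) x y) O hAO)).toSubring := by
      rw [hR₁, hA]
      exact locAtCentre_eq_ofPrime hAO
    subst hR₁T
    have hφ : Subring.inclusion h.le x =
        algebraMap (chartAdjoin (K := K) x y) _ (chartIncl (K := K) x y x) := Subtype.ext rfl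
    have hspanφ : Ideal.span {Subring.inclusion h.le x} =
        (Ideal.span {chartIncl (K := K) x y x}).map (algebraMap (chartAdjoin (K := K) x y) _) := by
      rw [Ideal.map_span, Set.image_singleton, hφ]
    have h1 : 𝔭 = Ideal.span {Subring.inclusion h.le x} := by
      rw [hspanφ]
      refine eq_map_of_forall_prime_between_primeDichotomy _ hbetween 𝔭 h𝔭m ?_
      rw [← hspanφ, Ideal.span_singleton_le_iff_mem]
      exact hx𝔭
    refine ⟨h1, ?_⟩
    have hne : 𝔭.comap (Subring.inclusion h.le) ≠ ⊤ := Ideal.comap_ne_top _ h𝔭.ne_top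
    refine le_antisymm (IsLocalRing.le_maximalIdeal hne) ?_
    rw [h1]
    exact hmle

end Summit.ResolutionOfSingularities.ResolutionOfSingularities.Theorems.PfaffLine

end
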